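import Summits.BirchSwinnertonDyer.Rank1Residual.AdditivePotMult.RankOneHeegnerAnyPrime
import Literature.NumberTheory.EllipticCurves.Rank1Residual.Typed.KolyvaginCertificate
import HarnessLib

/-!
# Rank ONE at an additive (indeed ANY) prime `p ≥ 5`: the EXACT Heegner-index certificate — `p ∤ [E(K):ℤy_K]` and `ord_p L(E^{d_K},1)/Ω = 0` give `ord_p #Ш(E)_an = 0` AND `BSD(E,p)` (cell `b2b-bsdres`, sub-cell additive-p1, gen 5)

HONEST FRAMING (cell `b2b-bsdres`, run/shared/lean/b2b/bsd-rank1-residual/, verbatim in every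
file): the goal of the cell is to DELETE the COMBINATION-SHAPED residual classes of the
Birch–Swinnerton-Dyer formula for ALL analytic-rank `≤ 1` elliptic curves over `ℚ` — "full BSD
formula for every rank `≤ 1` curve in class `C`" assembled STRICTLY from published theorems — so
that the rank-`≤ 1` remainder becomes exactly the CONSTRUCTION-SHAPED classes, which are TYPED
(missing-input `Prop`s), NOT attempted. This is not "finishing BSD". Sub-cell additive-p1 is a
RESEARCH ROUTE on the construction-shaped classes X3♯(M) / X4(M) (additive, potentially
multiplicative `p`); no claim beyond the stated sub-classes; X3/X4 labels are UNCHANGED by this file;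
NOTHING is booked here (a per-pair closure is the referee's ruling on the lane's certificates).

THEOREMS ONLY (no definition, no named fact). PER PAIR, not a class theorem.

## What this file records

At an ADDITIVE prime `p ≥ 5` of a curve of analytic rank ONE no instrument of the cell reaches
`BSD(E,p)` (no `p`-descent at `p ≥ 5`; no main conjecture at an additive prime; Cha 2005 needs
`p² ∤ N`, GJPST 2009 p. 2406): the census of record (hyp_bits.tsv, `N < 2·10⁴`) lists all 11
rank-one X4(M) pairs at `p ≥ 5` as `RESISTANT … twist Heegner index not certified`. What DOES reach
them is KOLYVAGIN — the tree's PUBLISHED fact `Kolyvagin1990_padicValNat_card_sha_le` (McCallum 1991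
§1 / Gross 1991 Thm. 1.3: `ord_p #Ш(E/K) ≤ 2·ord_p [E(K):ℤ y_K]`, `p` odd, `ρ̄` onto, NO hypothesis
at `p`) through the cell's consumer `Typed.bsdp_of_kolyvagin_of_not_dvd_index`, which however carries
the rank-one value `#Ш(E)_an = q, ord_p q = 0` as a BINDER (a statement about the real number
`L'(E,1)/(Ω_E Reg_E)`). This file removes that binder: by multr1-p2's Gross–Zagier bookkeeping
identity `X11b.exists_shaAn_padicVal_eq_of_heegner` (JSW 2017 (eq:gz for K′), exact at odd `p`,
no reduction hypothesis at `p`),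
  `ord_p #Ш(E)_an + ord_p (L(E^{d_K},1)/Ω_{E^{d_K}}) + ord_p ∏_ℓ c_ℓ(E) + 2·ord_p #E^{d_K}(ℚ)_tors
      = 2·ord_p [E(K) : ℤ P]`,
so the FINITE certificate `p ∤ [E(K):ℤP]` ∧ `ord_p L(E^{d_K},1)/Ω_{E^{d_K}} = 0` ∧ `p ∤ ∏_ℓ c_ℓ(E)`
(∧ `p ∤ c(D)`; `E[p]` irreducible, so the twist has no rational `p`-torsion) GIVES
`ord_p #Ш(E)_an = 0` as a THEOREM, whence `BSD(E,p)` (Kolyvagin: `Ш(E/K)[p] = 0`, restriction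
injective on `Ш(E/ℚ)[p]`) AND `BSD(E^{d_K},p)` for the rank-zero Heegner twist
(`ord_p #Ш(E/K) = ord_p #Ш(E) + ord_p #Ш(E^{d_K}) = 0`, rank-zero print shape, Tamagawa transport).

* §1 (data level, any level `N` of the datum, `p` odd): `padicValRat_shaAn_eq_zero_of_indexCertificate`,
  `bsdp_of_rankOne_of_indexCertificate`.
* §2 (conductor level, `p ≥ 5`, `w_K = 2` from `d_K < −4`): `bsdp_and_bsdp_twist_of_indexCertificate`
  (`p` split in `K`: `SatisfiesHeegnerHypothesis p K`), `…_of_dvd` (`p ∣ N_E`: automatic under the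
  Heegner hypothesis — the case of every ADDITIVE or multiplicative `p`).
* §3 (this sub-cell): `ClassX4M.bsdp_rankOne_of_indexCertificate_of_ram` — on X4(M) ∧ (ram) the
  image hypothesis is DISCHARGED (`surj_of_irr_of_ram`), so the certificate is purely
  (`K`, `P`, `p ∤ I_K`, `ord_p L(E^{d_K},1)/Ω = 0`, `p ∤ ∏c_ℓ`, `p ∤ c(D)`); `ClassX4.…` for any
  additive type under `Surj`.

Target population (`N < 2·10⁴`, this seat's `census-g5/kim_rows.json`): X4(M) ∧ `p ≥ 5` ∧ `r_an = 1`
= 11 pairs, ALL with `ρ̄` onto and a Manin-unit datum: 8 with `p ∤ ∏c_ℓ` (`14850bw1, 17550b1,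
17700m1, 18150ba1, 18150be1, 18150ce1, 18450bf1, 18450bn1`, all `@5`) — certificate candidates; 3
with `p ∣ ∏c_ℓ` (`5775r1@5, 19425q1@5, 18326j1@7`) — `p ∣ [E(K):ℤP]` expected there (the identity,
granted the BSD shape of the two values). Class-agnostic: rank-one X4 (any type), X7, X8, X11 ∧ ¬(ram)
pairs at `p ≥ 5` with `ρ̄` onto are served verbatim. Certification (two engines) is lane business;
NOTHING is booked by this file.

References: [McCallumLMS1991] §1; [GrossLMS1991] Thm. 1.3 / Prop. 2.1; [Kolyvagin1990] Thm. A;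
[JetchevSkinnerWan2017] §7.4; [GrossZagier1986], [CaiShuTian2014]; [Miller2011LMS] Def. 1.1;
[GrigorovJorzaPatrikisSteinTarnita2009] p. 2406; [Serre1972] §3.1.
-/

noncomputable section

open scoped Classical NumberField

open WeierstrassCurve NumberField Literature.NumberTheory.EllipticCurves
  Literature.NumberTheory.EllipticCurves.ModularForms
  Literature.NumberTheory.EllipticCurves.Rank1Residual
  Literature.NumberTheory.EllipticCurves.Rank1Residual.Typed
  Literature.NumberTheory.EllipticCurves.KrizLi2019
  Literature.NumberTheory.QuadraticFields
  Literature.NumberTheory.Automorphic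
  IsDedekindDomain

namespace Summit.BirchSwinnertonDyer.Rank1Residual.AdditivePotMult

/-! ### §1 Data level: the exact certificate gives `ord_p #Ш(E)_an = 0` and `BSD(E,p)` -/

/-- **`ord_p #Ш(E)_an = 0` from the finite index certificate, rank one, ANY odd `p`, any reduction
type.** Data: `W/ℚ` globally minimal with `ord_{s=1} L(E,s) = 1` and `E[p]` irreducible; `K`
imaginary quadratic with the Heegner hypothesis for the level `N`; `P ∈ E(K)` the Heegner point of
a parametrisation datum `Dt` with `p ∤ c(Dt)`; `p` odd with `p ∤ #𝓞_K^×`; `Wd = Cd • W^{(d_K)}` a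
globally minimal model of the twist with `ord_p u(Cd) = 0`. CERTIFICATE: the twist's algebraic
central value `q_d = L(E^{d_K},1)/Ω_{E^{d_K}} ≠ 0` with `ord_p q_d = 0`, `p ∤ [E(K) : ℤP]`, and
`p ∤ ∏_ℓ c_ℓ(E)`. CONCLUSION: `#Ш(E)_an = q ∈ ℚ` with `ord_p q = 0`. Proof: multr1-p2's identity
`X11b.exists_shaAn_padicVal_eq_of_heegner` (`ord_p q + ord_p q_d + ord_p ∏c_ℓ + 2·ord_p #E^{d_K}(ℚ)_tors
= 2·ord_p [E(K):ℤP]`), the vanishing of every other term (the twist inherits irreducibility, x11b's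
`hasIrreducibleModPGaloisRep_twist_model`, so it has no rational `p`-torsion, Mazur 1977). PUBLISHED
binders: Gross–Zagier `hGZ`, Kolyvagin (qualitative) `hKo`, GZK `hGZK`, modularity `hmod`. Per pair.
[cite: JetchevSkinnerWan2017, §7.4.1 (eq:gz for K′) and §7.3.1 (eq:tamK), pp. 29–30]
[cite: GrossZagier1986, V.§2 (pp. 310–312)] [cite: Miller2011LMS, §1 and Def. 1.1] -/
theorem padicValRat_shaAn_eq_zero_of_indexCertificate
    (W : WeierstrassCurve ℚ) [W.IsElliptic] [W.IsGloballyMinimal] (p : ℕ) [Fact p.Prime]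
    (N : ℕ) [NeZero N] (K : Type) [Field K] [NumberField K]
    (Dt : ModularParametrizationData W N) (H : HeegnerDatum N (NumberField.discr K)) (ι : K →+* ℂ)
    (P : (W.baseChange K).toAffine.Point)
    -- the published inputs (named facts of the tree)
    (hGZ : gross_zagier N W K) (hKo : kolyvagin N W K)
    (hGZK : rank_eq_analyticRank_of_analyticRank_le_one) (hmod : hasEntireLFunction_rat)
    -- the pair and the Heegner data
    (hK : IsImaginaryQuadratic K) (hHN : SatisfiesHeegnerHypothesis N K)
    (hP : WeierstrassCurve.Affine.Point.map ι.toRatAlgHom P = heegnerPointComplex Dt H)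
    (hp2 : p ≠ 2) (hc : ¬ (p : ℤ) ∣ Dt.c) (hμ : ¬ p ∣ Units.torsionOrder K)
    (hr : W.analyticRank = 1) (hirr : Irr W p)
    (Wd : WeierstrassCurve ℚ) [Wd.IsElliptic] [Wd.IsGloballyMinimal] (Cd : VariableChange ℚ)
    (hWd : Cd • W.quadraticTwist (NumberField.discr K : ℚ) = Wd)
    (hu : padicValRat p (Cd.u : ℚ) = 0)
    -- the certificate
    (qd : ℚ) (hqd : Wd.entireLFunction 1 / (Wd.realPeriodRat : ℂ) = (qd : ℂ)) (hqd0 : qd ≠ 0)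
    (hvd : padicValRat p qd = 0) (hI : ¬ p ∣ (AddSubgroup.zmultiples P).index)
    (htam : ¬ p ∣ W.tamagawaProduct) :
    ∃ q : ℚ, shaAn W = (q : ℂ) ∧ padicValRat p q = 0 := by
  have hD0 : (NumberField.discr K : ℚ) ≠ 0 := by exact_mod_cast NumberField.discr_ne_zero K
  haveI hEt : (W.quadraticTwist (NumberField.discr K : ℚ)).IsElliptic :=
    W.isElliptic_quadraticTwist hD0
  -- the twist's central value is non-zero (`q_d ≠ 0`)
  have hLt' : (W.quadraticTwist (NumberField.discr K : ℚ)).entireLFunction = Wd.entireLFunction := by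
    rw [← hWd, entireLFunction_smul]
  have hΩdC : (Wd.realPeriodRat : ℂ) ≠ 0 := by exact_mod_cast Wd.realPeriodRat_pos_holds.ne'
  have hLt : (W.quadraticTwist (NumberField.discr K : ℚ)).entireLFunction 1 ≠ 0 := by
    rw [hLt']
    intro h0
    apply hqd0
    have : ((qd : ℂ)) = 0 := by rw [← hqd, h0, zero_div]
    exact_mod_cast this
  -- the twist has no rational `p`-torsion
  have hirrd : Wd.HasIrreducibleModPGaloisRep p :=
    X11b.hasIrreducibleModPGaloisRep_twist_model W p K hK.1 hirr Cd hWd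
  have htors : padicValNat p Wd.torsionOrder = 0 :=
    padicValNat_torsionOrder_eq_zero_of_irreducible Wd p hirrd
  -- the Gross–Zagier bookkeeping identity
  obtain ⟨-, -, -, q, hq, hid⟩ :=
    X11b.exists_shaAn_padicVal_eq_of_heegner W p N K Dt H ι P hGZ hKo hGZK hmod hK hHN hP hp2 hc hμ
      hr hLt Wd Cd hWd hu qd hqd
  refine ⟨q, hq, ?_⟩
  rw [hvd, htors, padicValNat.eq_zero_of_not_dvd htam, padicValNat.eq_zero_of_not_dvd hI] at hid
  simpa using hid

/-- **`BSD(E,p)` in rank one from the exact index certificate, ANY odd `p` with `ρ̄_{E,p}` onto, any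
reduction type at `p` (additive included).** Same data and certificate as
`padicValRat_shaAn_eq_zero_of_indexCertificate`, plus Kolyvagin's QUANTITATIVE bound `hB`
(`Kolyvagin1990_padicValNat_card_sha_le`, McCallum 1991 §1: `ord_p #Ш(E/K) ≤ 2·ord_p [E(K):ℤy_K]`,
`p` odd, `ρ̄` onto — no hypothesis at `p`) and surjectivity `hsurj`. Then `BSDp W p`: the value
`ord_p #Ш(E)_an = 0` is §1's theorem, and `Ш(E/ℚ)[p] = 0` is the cell's
`Typed.bsdp_of_kolyvagin_of_not_dvd_index` (`Ш(E/K)[p] = 0`, restriction injective on `Ш(E/ℚ)[p]`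
for `p` odd). The Heegner point is non-torsion because `L'(E/K,1) = L'(E,1)·L(E^{d_K},1) ≠ 0`
(Gross–Zagier). Per pair; nothing booked. [cite: McCallumLMS1991, §1 Theorem (Kolyvagin), p. 296]
[cite: GrossLMS1991, §2 Prop. 2.1 (2)] [cite: JetchevSkinnerWan2017, §7.4.1 (eq:gz for K′)]
[cite: Miller2011LMS, Def. 1.1] -/
theorem bsdp_of_rankOne_of_indexCertificate
    (W : WeierstrassCurve ℚ) [W.IsElliptic] [W.IsGloballyMinimal] (p : ℕ) [Fact p.Prime]
    (N : ℕ) [NeZero N] (K : Type) [Field K] [NumberField K]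
    (Dt : ModularParametrizationData W N) (H : HeegnerDatum N (NumberField.discr K)) (ι : K →+* ℂ)
    (P : (W.baseChange K).toAffine.Point)
    -- the published inputs (named facts of the tree)
    (hGZ : gross_zagier N W K) (hKo : kolyvagin N W K)
    (hB : Kolyvagin1990_padicValNat_card_sha_le N W K)
    (hGZK : rank_eq_analyticRank_of_analyticRank_le_one) (hmod : hasEntireLFunction_rat)
    -- the pair and the Heegner data
    (hK : IsImaginaryQuadratic K) (hHN : SatisfiesHeegnerHypothesis N K)
    (hP : WeierstrassCurve.Affine.Point.map ι.toRatAlgHom P = heegnerPointComplex Dt H)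
    (hp2 : p ≠ 2) (hc : ¬ (p : ℤ) ∣ Dt.c) (hμ : ¬ p ∣ Units.torsionOrder K)
    (hr : W.analyticRank = 1) (hsurj : Surj W p)
    (Wd : WeierstrassCurve ℚ) [Wd.IsElliptic] [Wd.IsGloballyMinimal] (Cd : VariableChange ℚ)
    (hWd : Cd • W.quadraticTwist (NumberField.discr K : ℚ) = Wd)
    (hu : padicValRat p (Cd.u : ℚ) = 0)
    -- the certificate
    (qd : ℚ) (hqd : Wd.entireLFunction 1 / (Wd.realPeriodRat : ℂ) = (qd : ℂ)) (hqd0 : qd ≠ 0)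
    (hvd : padicValRat p qd = 0) (hI : ¬ p ∣ (AddSubgroup.zmultiples P).index)
    (htam : ¬ p ∣ W.tamagawaProduct) :
    BSDp W p := by
  have hp : p.Prime := Fact.out
  have hirr : Irr W p := hasIrreducibleModPGaloisRep_of_hasSurjectiveModNGaloisRep W p hsurj
  obtain ⟨q, hq, hv⟩ :=
    padicValRat_shaAn_eq_zero_of_indexCertificate W p N K Dt H ι P hGZ hKo hGZK hmod hK hHN hP hp2 hc
      hμ hr hirr Wd Cd hWd hu qd hqd hqd0 hvd hI htam
  -- the Heegner point is non-torsion: `L'(E/K,1) ≠ 0`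
  have hD0 : (NumberField.discr K : ℚ) ≠ 0 := by exact_mod_cast NumberField.discr_ne_zero K
  haveI hEt : (W.quadraticTwist (NumberField.discr K : ℚ)).IsElliptic :=
    W.isElliptic_quadraticTwist hD0
  have hLt' : (W.quadraticTwist (NumberField.discr K : ℚ)).entireLFunction = Wd.entireLFunction := by
    rw [← hWd, entireLFunction_smul]
  have hLt : (W.quadraticTwist (NumberField.discr K : ℚ)).entireLFunction 1 ≠ 0 := by
    rw [hLt']
    intro h0
    apply hqd0
    have : ((qd : ℂ)) = 0 := by rw [← hqd, h0, zero_div]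
    exact_mod_cast this
  have hPH : IsHeegnerPoint N W K P := ⟨Dt, H, ι, hP⟩
  have hL0 : W.entireLFunction 1 = 0 := entireLFunction_one_eq_zero_of_analyticRank_eq_one hr
  obtain ⟨-, hderiv⟩ := leadingLCoeff_eq_deriv_of_analyticRank_eq_one hr
  have hLK : LDerivEK W K ≠ 0 := by
    rw [lDerivEK_eq_deriv_mul W K hmod hL0]
    exact mul_ne_zero hderiv hLt
  have hnt : ¬ IsOfFinAddOrder P :=
    (lDerivEK_ne_zero_iff_not_isOfFinAddOrder W N K hGZ hK hHN hPH).mp hLK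
  exact bsdp_of_kolyvagin_of_not_dvd_index W p hGZK hKo hB hK hHN hPH hnt hp2 hsurj hI (le_of_eq hr)
    hq hv

/-! ### §2 Conductor level, `p ≥ 5`: the twist is closed too; `ord_p u = 0` and `w_K = 2` discharged -/

/-- **Rank one, ANY `p ≥ 5` split in the Heegner field: the exact index certificate closes BOTH the
pair and its rank-zero Heegner twist at `p`.** `W/ℚ` globally minimal, `ord_{s=1} L(E,s) = 1`,
`ρ̄_{E,p}` onto; `K` imaginary quadratic with the Heegner hypothesis for `N_E` AND for `p`
(`p` splits — automatic when `p ∣ N_E`, see `…_of_dvd`), `d_K < −4`; the `K`-rational Heegner point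
`P` of a parametrisation datum `Dt` at level `N_E` with `p ∤ c(Dt)`; `Wd = Cd • W^{(d_K)}` any
globally minimal model of the twist. CERTIFICATE: `q_d = L(E^{d_K},1)/Ω(Wd) ≠ 0`, `ord_p q_d = 0`,
`p ∤ [E(K):ℤP]`, `p ∤ ∏_ℓ c_ℓ(E)`. CONCLUSION: `BSDp W p ∧ BSDp Wd p`. The twist: Kolyvagin's bound
gives `ord_p #Ш(E/K) = 0`, the identity's `ord_p #Ш(E/K) = ord_p #Ш(E) + ord_p #Ш(Wd)` gives
`ord_p #Ш(Wd) = 0`, the Tamagawa transport (x11b, `p ≥ 5`, every bad prime of `E` split in `K`)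
gives `p ∤ ∏c_ℓ(Wd)`, irreducibility transports, and the rank-zero print shape
(`bsdp_of_pPartRankZero`) finishes. `ord_p u(Cd) = 0` is `padicValRat_u_eq_zero_of_twist_minimal_of_split`;
`w_K = 2` from `d_K < −4`. Per pair; nothing booked; class-agnostic (X4 any type, X7, X8, X11).
[cite: McCallumLMS1991, §1 Theorem (Kolyvagin), p. 296] [cite: JetchevSkinnerWan2017, §7.4 (pp. 29–31)]
[cite: Skinner2016PacificMC, Thm. C (display, print shape only)] [cite: Miller2011LMS, Def. 1.1] -/
theorem bsdp_and_bsdp_twist_of_indexCertificate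
    (W : WeierstrassCurve ℚ) [W.IsElliptic] [W.IsGloballyMinimal] (p : ℕ) [Fact p.Prime]
    [NeZero (W.conductorNorm ℤ)] (K : Type) [Field K] [NumberField K]
    (Dt : ModularParametrizationData W (W.conductorNorm ℤ))
    (H : HeegnerDatum (W.conductorNorm ℤ) (NumberField.discr K)) (ι : K →+* ℂ)
    (P : (W.baseChange K).toAffine.Point)
    -- the published inputs (named facts of the tree)
    (hGZ : gross_zagier (W.conductorNorm ℤ) W K) (hKo : kolyvagin (W.conductorNorm ℤ) W K)
    (hB : Kolyvagin1990_padicValNat_card_sha_le (W.conductorNorm ℤ) W K)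
    (hGZK : rank_eq_analyticRank_of_analyticRank_le_one) (hmod : hasEntireLFunction_rat)
    -- the pair and the Heegner data
    (hp5 : 5 ≤ p) (hr : W.analyticRank = 1) (hsurj : Surj W p)
    (hK : IsImaginaryQuadratic K) (hHN : SatisfiesHeegnerHypothesis (W.conductorNorm ℤ) K)
    (hHp : SatisfiesHeegnerHypothesis p K) (hdK : NumberField.discr K < -4)
    (hP : WeierstrassCurve.Affine.Point.map ι.toRatAlgHom P = heegnerPointComplex Dt H)
    (hc : ¬ (p : ℤ) ∣ Dt.c)
    (Wd : WeierstrassCurve ℚ) [Wd.IsElliptic] [Wd.IsGloballyMinimal] (Cd : VariableChange ℚ)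
    (hWd : Cd • W.quadraticTwist (NumberField.discr K : ℚ) = Wd)
    -- the certificate
    (qd : ℚ) (hqd : Wd.entireLFunction 1 / (Wd.realPeriodRat : ℂ) = (qd : ℂ)) (hqd0 : qd ≠ 0)
    (hvd : padicValRat p qd = 0) (hI : ¬ p ∣ (AddSubgroup.zmultiples P).index)
    (htam : ¬ p ∣ W.tamagawaProduct) :
    BSDp W p ∧ BSDp Wd p := by
  have hp : p.Prime := Fact.out
  have hp2 : p ≠ 2 := by omega
  have hirr : Irr W p := hasIrreducibleModPGaloisRep_of_hasSurjectiveModNGaloisRep W p hsurj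
  -- `w_K = 2`, prime to `p`
  have hμ : ¬ p ∣ Units.torsionOrder K := by
    rw [Literature.NumberTheory.DiophantineGeometry.torsionOrder_eq_two_of_discr_lt hK.1 hdK]
    intro h2
    have := Nat.le_of_dvd two_pos h2
    omega
  have hu : padicValRat p (Cd.u : ℚ) = 0 :=
    padicValRat_u_eq_zero_of_twist_minimal_of_split W p K hK hHp Cd hWd
  refine ⟨bsdp_of_rankOne_of_indexCertificate W p (W.conductorNorm ℤ) K Dt H ι P hGZ hKo hB hGZK hmod
    hK hHN hP hp2 hc hμ hr hsurj Wd Cd hWd hu qd hqd hqd0 hvd hI htam, ?_⟩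
  ---------------------------------------------------------------- the twist
  have hD0 : (NumberField.discr K : ℚ) ≠ 0 := by exact_mod_cast NumberField.discr_ne_zero K
  haveI hEt : (W.quadraticTwist (NumberField.discr K : ℚ)).IsElliptic :=
    W.isElliptic_quadraticTwist hD0
  have hLt' : (W.quadraticTwist (NumberField.discr K : ℚ)).entireLFunction = Wd.entireLFunction := by
    rw [← hWd, entireLFunction_smul]
  have hLt : (W.quadraticTwist (NumberField.discr K : ℚ)).entireLFunction 1 ≠ 0 := by
    rw [hLt']
    intro h0
    apply hqd0
    have : ((qd : ℂ)) = 0 := by rw [← hqd, h0, zero_div]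
    exact_mod_cast this
  have hLd1 : Wd.entireLFunction 1 ≠ 0 := by rw [← hLt']; exact hLt
  have hrd : Wd.analyticRank = 0 := (Wd.analyticRank_eq_zero_iff_holds (hmod Wd)).2 hLd1
  have hirrd : Wd.HasIrreducibleModPGaloisRep p :=
    X11b.hasIrreducibleModPGaloisRep_twist_model W p K hK.1 hirr Cd hWd
  have htors : padicValNat p Wd.torsionOrder = 0 :=
    padicValNat_torsionOrder_eq_zero_of_irreducible Wd p hirrd
  have htamd : padicValNat p Wd.tamagawaProduct = 0 := by
    rw [X11b.padicValNat_tamagawaProduct_twist_of_heegner W p hp5 K hK hHN Cd hWd]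
    exact padicValNat.eq_zero_of_not_dvd htam
  -- the identity: finiteness and the `Ш` decomposition over `K`
  obtain ⟨hfinW, hfinK, hsum, -⟩ :=
    X11b.exists_shaAn_padicVal_eq_of_heegner W p (W.conductorNorm ℤ) K Dt H ι P hGZ hKo hGZK hmod hK
      hHN hP hp2 hc hμ hr hLt Wd Cd hWd hu qd hqd
  -- the Heegner point is non-torsion; Kolyvagin's bound kills `Ш(E/K)[p^∞]`
  have hPH : IsHeegnerPoint (W.conductorNorm ℤ) W K P := ⟨Dt, H, ι, hP⟩
  have hL0 : W.entireLFunction 1 = 0 := entireLFunction_one_eq_zero_of_analyticRank_eq_one hr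
  obtain ⟨-, hderiv⟩ := leadingLCoeff_eq_deriv_of_analyticRank_eq_one hr
  have hLK : LDerivEK W K ≠ 0 := by
    rw [lDerivEK_eq_deriv_mul W K hmod hL0]
    exact mul_ne_zero hderiv hLt
  have hnt : ¬ IsOfFinAddOrder P :=
    (lDerivEK_ne_zero_iff_not_isOfFinAddOrder W (W.conductorNorm ℤ) K hGZ hK hHN hPH).mp hLK
  have hbound := hB hK hHN hPH hnt hp hp2 hsurj
  haveI : Finite (W.baseChange K).sha := hfinK
  have hKsha : padicValNat p (W.baseChange K).shaOrder = 0 := by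
    have h0 : padicValNat p (AddSubgroup.zmultiples P).index = 0 := padicValNat.eq_zero_of_not_dvd hI
    have : padicValNat p (Nat.card (W.baseChange K).sha) = 0 := by
      have := hbound; rw [h0, mul_zero] at this; exact Nat.le_zero.mp this
    simpa [WeierstrassCurve.shaOrder] using this
  have hshad : padicValNat p Wd.shaOrder = 0 := by
    rw [hKsha] at hsum
    omega
  -- the rank-zero print shape for the twist
  refine bsdp_of_pPartRankZero Wd p hmod hGZK hrd ⟨qd, hqd, ?_⟩
  rw [hvd, hshad, htamd, htors]
  simp

/-- **The same with `p ∣ N_E`** (every ADDITIVE or multiplicative `p`): the Heegner hypothesis for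
`N_E` makes `p` split in `K`, so `SatisfiesHeegnerHypothesis p K` is automatic
(`SatisfiesHeegnerHypothesis.of_dvd`-style bookkeeping via x11b's `isSquare_discr_padic_of_heegner`
is not even needed: `ord_p u = 0` is this sub-cell's `padicValRat_u_eq_zero_of_twist_minimal_of_dvd`).
Per pair; nothing booked. [cite: McCallumLMS1991, §1 Theorem (Kolyvagin), p. 296]
[cite: JetchevSkinnerWan2017, §7.4 (pp. 29–31)] [cite: Miller2011LMS, Def. 1.1] -/
theorem bsdp_and_bsdp_twist_of_indexCertificate_of_dvd
    (W : WeierstrassCurve ℚ) [W.IsElliptic] [W.IsGloballyMinimal] (p : ℕ) [Fact p.Prime]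
    [NeZero (W.conductorNorm ℤ)] (K : Type) [Field K] [NumberField K]
    (Dt : ModularParametrizationData W (W.conductorNorm ℤ))
    (H : HeegnerDatum (W.conductorNorm ℤ) (NumberField.discr K)) (ι : K →+* ℂ)
    (P : (W.baseChange K).toAffine.Point)
    -- the published inputs (named facts of the tree)
    (hGZ : gross_zagier (W.conductorNorm ℤ) W K) (hKo : kolyvagin (W.conductorNorm ℤ) W K)
    (hB : Kolyvagin1990_padicValNat_card_sha_le (W.conductorNorm ℤ) W K)
    (hGZK : rank_eq_analyticRank_of_analyticRank_le_one) (hmod : hasEntireLFunction_rat)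
    -- the pair and the Heegner data
    (hp5 : 5 ≤ p) (hpN : p ∣ W.conductorNorm ℤ) (hr : W.analyticRank = 1) (hsurj : Surj W p)
    (hK : IsImaginaryQuadratic K) (hHN : SatisfiesHeegnerHypothesis (W.conductorNorm ℤ) K)
    (hdK : NumberField.discr K < -4)
    (hP : WeierstrassCurve.Affine.Point.map ι.toRatAlgHom P = heegnerPointComplex Dt H)
    (hc : ¬ (p : ℤ) ∣ Dt.c)
    (Wd : WeierstrassCurve ℚ) [Wd.IsElliptic] [Wd.IsGloballyMinimal] (Cd : VariableChange ℚ)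
    (hWd : Cd • W.quadraticTwist (NumberField.discr K : ℚ) = Wd)
    -- the certificate
    (qd : ℚ) (hqd : Wd.entireLFunction 1 / (Wd.realPeriodRat : ℂ) = (qd : ℂ)) (hqd0 : qd ≠ 0)
    (hvd : padicValRat p qd = 0) (hI : ¬ p ∣ (AddSubgroup.zmultiples P).index)
    (htam : ¬ p ∣ W.tamagawaProduct) :
    BSDp W p ∧ BSDp Wd p := by
  have hHp : SatisfiesHeegnerHypothesis p K := SatisfiesHeegnerHypothesis.of_dvd hpN hHN
  exact bsdp_and_bsdp_twist_of_indexCertificate W p K Dt H ι P hGZ hKo hB hGZK hmod hp5 hr hsurj hK hHN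
    hHp hdK hP hc Wd Cd hWd qd hqd hqd0 hvd hI htam

/-! ### §3 This sub-cell: X4(M) (and X4) rank-one pairs at `p ≥ 5` -/

variable {W : WeierstrassCurve ℚ} [W.IsElliptic] {p : ℕ} [Fact p.Prime]

/-- **X4 (any additive type), rank one, `p ≥ 5`, `ρ̄` onto: `BSD(E,p)` from the exact index
certificate** — `p ∣ N_E` because `p` is additive. Per pair; X4's label unchanged; nothing booked.
[cite: McCallumLMS1991, §1 Theorem (Kolyvagin), p. 296] [cite: Miller2011LMS, Def. 1.1] -/
theorem ClassX4.bsdp_rankOne_of_indexCertificate [W.IsGloballyMinimal] [NeZero (W.conductorNorm ℤ)]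
    (hX : ClassX4 W p) (hp5 : 5 ≤ p) (hr : W.analyticRank = 1) (hsurj : Surj W p)
    (K : Type) [Field K] [NumberField K]
    (Dt : ModularParametrizationData W (W.conductorNorm ℤ))
    (H : HeegnerDatum (W.conductorNorm ℤ) (NumberField.discr K)) (ι : K →+* ℂ)
    (P : (W.baseChange K).toAffine.Point)
    (hGZ : gross_zagier (W.conductorNorm ℤ) W K) (hKo : kolyvagin (W.conductorNorm ℤ) W K)
    (hB : Kolyvagin1990_padicValNat_card_sha_le (W.conductorNorm ℤ) W K)
    (hGZK : rank_eq_analyticRank_of_analyticRank_le_one) (hmod : hasEntireLFunction_rat)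
    (hK : IsImaginaryQuadratic K) (hHN : SatisfiesHeegnerHypothesis (W.conductorNorm ℤ) K)
    (hdK : NumberField.discr K < -4)
    (hP : WeierstrassCurve.Affine.Point.map ι.toRatAlgHom P = heegnerPointComplex Dt H)
    (hc : ¬ (p : ℤ) ∣ Dt.c)
    (Wd : WeierstrassCurve ℚ) [Wd.IsElliptic] [Wd.IsGloballyMinimal] (Cd : VariableChange ℚ)
    (hWd : Cd • W.quadraticTwist (NumberField.discr K : ℚ) = Wd)
    (qd : ℚ) (hqd : Wd.entireLFunction 1 / (Wd.realPeriodRat : ℂ) = (qd : ℂ)) (hqd0 : qd ≠ 0)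
    (hvd : padicValRat p qd = 0) (hI : ¬ p ∣ (AddSubgroup.zmultiples P).index)
    (htam : ¬ p ∣ W.tamagawaProduct) :
    BSDp W p ∧ BSDp Wd p :=
  have hpN : p ∣ W.conductorNorm ℤ :=
    (W.dvd_conductorNorm_iff_not_hasGoodReductionAtPrime p).mpr (not_good_of_addv W p hX.2.1)
  bsdp_and_bsdp_twist_of_indexCertificate_of_dvd W p K Dt H ι P hGZ hKo hB hGZK hmod hp5 hpN hr hsurj
    hK hHN hdK hP hc Wd Cd hWd qd hqd hqd0 hvd hI htam

/-- **X4(M) ∧ (ram), rank one, `p ≥ 5`: the image hypothesis is DISCHARGED** (`surj_of_irr_of_ram`: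
irreducible + a (ram) prime ⇒ onto, Serre), so `BSD(E,p)` (and `BSD(E^{d_K},p)`) follow from the
finite certificate (`K`, `P`, `p ∤ [E(K):ℤP]`, `ord_p L(E^{d_K},1)/Ω = 0`, `p ∤ ∏c_ℓ(E)`,
`p ∤ c(Dt)`) and PUBLISHED facts alone. Census (`N < 2·10⁴`): 8 candidate pairs, all `@5`
(`14850bw1, 17550b1, 17700m1, 18150ba1, 18150be1, 18150ce1, 18450bf1, 18450bn1`). Per pair; X4(M)
stays CONSTRUCTION-SHAPED; nothing booked. [cite: McCallumLMS1991, §1 Theorem (Kolyvagin), p. 296]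
[cite: Serre1972, §3.1 and Prop. 21] [cite: Miller2011LMS, Def. 1.1] -/
theorem ClassX4M.bsdp_rankOne_of_indexCertificate_of_ram [W.IsGloballyMinimal]
    [NeZero (W.conductorNorm ℤ)]
    (hX : ClassX4M W p) (hp5 : 5 ≤ p) (hr : W.analyticRank = 1) (hram : Ram W p)
    (K : Type) [Field K] [NumberField K]
    (Dt : ModularParametrizationData W (W.conductorNorm ℤ))
    (H : HeegnerDatum (W.conductorNorm ℤ) (NumberField.discr K)) (ι : K →+* ℂ)
    (P : (W.baseChange K).toAffine.Point)
    (hGZ : gross_zagier (W.conductorNorm ℤ) W K) (hKo : kolyvagin (W.conductorNorm ℤ) W K)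
    (hB : Kolyvagin1990_padicValNat_card_sha_le (W.conductorNorm ℤ) W K)
    (hGZK : rank_eq_analyticRank_of_analyticRank_le_one) (hmod : hasEntireLFunction_rat)
    (hK : IsImaginaryQuadratic K) (hHN : SatisfiesHeegnerHypothesis (W.conductorNorm ℤ) K)
    (hdK : NumberField.discr K < -4)
    (hP : WeierstrassCurve.Affine.Point.map ι.toRatAlgHom P = heegnerPointComplex Dt H)
    (hc : ¬ (p : ℤ) ∣ Dt.c)
    (Wd : WeierstrassCurve ℚ) [Wd.IsElliptic] [Wd.IsGloballyMinimal] (Cd : VariableChange ℚ)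
    (hWd : Cd • W.quadraticTwist (NumberField.discr K : ℚ) = Wd)
    (qd : ℚ) (hqd : Wd.entireLFunction 1 / (Wd.realPeriodRat : ℂ) = (qd : ℂ)) (hqd0 : qd ≠ 0)
    (hvd : padicValRat p qd = 0) (hI : ¬ p ∣ (AddSubgroup.zmultiples P).index)
    (htam : ¬ p ∣ W.tamagawaProduct) :
    BSDp W p ∧ BSDp Wd p :=
  ClassX4.bsdp_rankOne_of_indexCertificate hX.1 hp5 hr (surj_of_irr_of_ram W p hX.irr hram) K Dt H ι
    P hGZ hKo hB hGZK hmod hK hHN hdK hP hc Wd Cd hWd qd hqd hqd0 hvd hI htam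

end Summit.BirchSwinnertonDyer.Rank1Residual.AdditivePotMult

end
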